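import Summits.HubbardSuperconductivity.HubbardSuperconductivity.Theses.LevyLogBootstrap
import HarnessLib

/-!
# Route `LevyLogBootstrap`, assembly (stmt-HubbardSuperconductivity-15051)

`Assembly := Block2InfDivXXZ → LevyTransport → DressHalfFilled → Continuation → HubbardSuperconductivity`
is exactly the route's deciding theorem `closes` (pure logic: LevyTransport applied to Block2InfDivXXZ is
HalfFilledOrder, the antecedent of DressHalfFilled; Continuation turns its output into the summit statement).
No definition is introduced; sorry-free.
-/

set_option linter.dupNamespace false

namespace Summit.HubbardSuperconductivity.HubbardSuperconductivity.Theorems.LevyLogBootstrap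

open Summit.HubbardSuperconductivity.HubbardSuperconductivity.Theses.LevyLogBootstrap

/-- **`Assembly` holds** (item stmt-HubbardSuperconductivity-15051): the route's deciding theorem
`closes`, curried. [folklore] -/
theorem assembly_proof :
    Summit.HubbardSuperconductivity.HubbardSuperconductivity.Theses.LevyLogBootstrap.Assembly :=
  fun h1 h2 h3 h4 => closes h1 h2 h3 h4

end Summit.HubbardSuperconductivity.HubbardSuperconductivity.Theorems.LevyLogBootstrap
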